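import Summits.QuantumFields.BalabanUV.T4Continuum.Support.DirichletHoleFilling

/-!
# `BalabanUV.T4Continuum.Support.TorusSlicing` — NE2 (node U1a) formalisation swarm, sub-row `T4-U1a.S-NE2-D1-DIRICHLET°`, supplier item
# «Δ1-HOLEFILL» (tube decay, part 1): SLICING THE TORUS ALONG ONE DIRECTION — `Tor N ≃ ZMod (N μ₀) × Tor N′`, `N′ = N ∘ μ₀.succAbove`
# (`Fin.insertNthEquiv`); torus sums split into longitudinal × transversal sums; transversal differences act inside the slices, the
# longitudinal difference across them (unit b2b-balaban-t4-ne2-formalise-leaf-08, gen 6, file 11)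

HONEST FRAMING.  Rung (B)+1 bookkeeping at MODEL level; [folklore] finite lattice calculus; NE2 (U1a) is NOT proved by this file; spine
PROVED 0/9 unchanged; NOT infinite volume, NOT the mass gap, NOT Clay.  HONEST DEPENDENCY (verbatim): «continuum YM on T⁴ ⇐ BetaPertH ∧ nine
spine estimates (0/9 proved); BetaPertH ⇐ (D1) ∧ (D4) ∧ CAP+tail; G-an2-4 gates asym, D1 and NE2/3/4.»

WHY (memo `t4/T4-EST-NE2-D1-HOLEFILL.md` §4).  LINE-type conflict loci of the located residue of «Δ1-LOCAL» need TUBE decay: hole-filling in the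
`d′ = d − 1 ≥ 2` transversal directions, slice by slice, with a fixed longitudinal cutoff.  This file is the slicing bookkeeping that lets the
cube theory (`CoordAnnulusPoincare`, `DirichletHoleFilling`) run VERBATIM on each slice `zsl t : Tor N′ → ℂ`, `zsl t y = z (ins t y)`:
 * §1 `Nsl N μ₀ = N ∘ μ₀.succAbove`, `ins μ₀ t y = Fin.insertNth μ₀ t y`, `zsl`; **`sum_torus_slice`** `Σ_x G x = Σ_t Σ_y G (ins t y)`;
 * §2 steps: `ins t y + e_{μ₀.succAbove j} = ins t (y + e_j)`, `ins t y + e_{μ₀} = ins (t+1) y`; hence **`sdiff_succAbove_ins`**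
   (`(∂_{succAbove j} z)(ins t y) = (∂_j (zsl t))(y)`) and **`sdiff_self_ins`** (`(∂_{μ₀} z)(ins t y) = c·(zsl (t+1) y − zsl t y)`);
 * §3 **`sum_dir_succAbove`**: a sum over all `d + 1` directions is the `μ₀`-term plus the sum over the transversal directions (`Fin.sum_univ_succAbove`).

ABSOLUTE RULE (cell, verbatim): «No internally-minted statement may enter as a cited fact. Every hypothesis is either kernel-proved in
this package or a verbatim quotation of a PUBLISHED theorem with page reference. The manuscript(s) under audit are NOT citable for
their own disputed steps — they are the thing under adjudication; programme-internal (2001/route/tribunal) claims are never citable.»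
[folklore]; plain data `def`s (`Nsl`, `ins`, `zsl`), no `def … : Prop` fact.  NOT CLAIMED: anything analytic; NE2.
-/

noncomputable section

open scoped BigOperators ComplexConjugate Matrix
open Finset

namespace Summit.QuantumFields.BalabanUV.T4Continuum.TorusSlicing

open Literature.MathematicalPhysics.QuantumFieldTheory.Balaban1983to89.B5Prop11Plancherel (Tor unitVec)
open Literature.MathematicalPhysics.QuantumFieldTheory.Balaban1983to89.B5Action121 (sdiff sdiff_mulVec)

variable {d : ℕ} (N : Fin (d + 1) → ℕ) [hN : ∀ μ, NeZero (N μ)] (μ₀ : Fin (d + 1))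

/-! ## §1 The transversal torus and the slices -/

/-- the TRANSVERSAL periods `N′ = N ∘ μ₀.succAbove`. [folklore] -/
def Nsl : Fin d → ℕ := fun j => N (μ₀.succAbove j)

/-- the transversal periods are non-zero. [folklore] -/
instance instNeZeroNsl (j : Fin d) : NeZero (Nsl N μ₀ j) := hN (μ₀.succAbove j)

omit hN in
/-- INSERTING the longitudinal coordinate: `ins t y` is the torus point with `μ₀`-coordinate `t` and transversal coordinates `y`. [folklore] -/
def ins (t : ZMod (N μ₀)) (y : Tor (Nsl N μ₀)) : Tor N := Fin.insertNth μ₀ t y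

omit hN in
/-- the SLICE of a field at longitudinal position `t`. [folklore] -/
def zsl (z : Tor N → ℂ) (t : ZMod (N μ₀)) : Tor (Nsl N μ₀) → ℂ := fun y => z (ins N μ₀ t y)

omit hN in
/-- coordinates of `ins`: the `μ₀`-one. [folklore] -/
theorem ins_apply_self (t : ZMod (N μ₀)) (y : Tor (Nsl N μ₀)) : ins N μ₀ t y μ₀ = t := Fin.insertNth_apply_same _ _ _

omit hN in
/-- coordinates of `ins`: the transversal ones. [folklore] -/
theorem ins_apply_succAbove (t : ZMod (N μ₀)) (y : Tor (Nsl N μ₀)) (j : Fin d) : ins N μ₀ t y (μ₀.succAbove j) = y j :=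
  Fin.insertNth_apply_succAbove _ _ _ _

/-- **SLICING OF TORUS SUMS**: `Σ_x G x = Σ_t Σ_y G (ins t y)`. [folklore] -/
theorem sum_torus_slice {β : Type*} [AddCommMonoid β] (G : Tor N → β) :
    ∑ x : Tor N, G x = ∑ t : ZMod (N μ₀), ∑ y : Tor (Nsl N μ₀), G (ins N μ₀ t y) := by
  rw [← Fintype.sum_prod_type']
  exact (Fintype.sum_equiv (Fin.insertNthEquiv (fun μ => ZMod (N μ)) μ₀) _ _ (fun _ => rfl)).symm

/-! ## §2 Steps: transversal inside the slice, longitudinal across slices -/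

omit hN in
/-- a transversal unit step stays in the slice: `ins t y + e_{succAbove j} = ins t (y + e_j)`. [folklore] -/
theorem ins_add_unitVec_succAbove (t : ZMod (N μ₀)) (y : Tor (Nsl N μ₀)) (j : Fin d) :
    ins N μ₀ t y + unitVec N (μ₀.succAbove j) = ins N μ₀ t (y + unitVec (Nsl N μ₀) j) := by
  funext i
  rcases Fin.eq_self_or_eq_succAbove μ₀ i with h0 | ⟨l, hl⟩
  · subst h0
    rw [Pi.add_apply, ins_apply_self, ins_apply_self, unitVec, Pi.single_eq_of_ne (Fin.succAbove_ne i j).symm, add_zero]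
  · subst hl
    rw [Pi.add_apply, ins_apply_succAbove, ins_apply_succAbove, Pi.add_apply, unitVec, unitVec]
    by_cases h : l = j
    · subst h; rw [Pi.single_eq_same, Pi.single_eq_same]; rfl
    · rw [Pi.single_eq_of_ne h, Pi.single_eq_of_ne (fun e => h (Fin.succAbove_right_injective e)), add_zero, add_zero]

omit hN in
/-- the longitudinal unit step moves to the next slice: `ins t y + e_{μ₀} = ins (t + 1) y`. [folklore] -/
theorem ins_add_unitVec_self (t : ZMod (N μ₀)) (y : Tor (Nsl N μ₀)) : ins N μ₀ t y + unitVec N μ₀ = ins N μ₀ (t + 1) y := by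
  funext i
  rcases Fin.eq_self_or_eq_succAbove μ₀ i with h0 | ⟨l, hl⟩
  · subst h0
    rw [Pi.add_apply, ins_apply_self, ins_apply_self, unitVec, Pi.single_eq_same]
  · subst hl
    rw [Pi.add_apply, ins_apply_succAbove, ins_apply_succAbove, unitVec, Pi.single_eq_of_ne (Fin.succAbove_ne μ₀ l), add_zero]

/-- **TRANSVERSAL DIFFERENCES ACT INSIDE THE SLICE**: `(∂_{succAbove j} z)(ins t y) = (∂_j (zsl t))(y)`. [folklore] -/
theorem sdiff_succAbove_ins (c : ℂ) (z : Tor N → ℂ) (t : ZMod (N μ₀)) (y : Tor (Nsl N μ₀)) (j : Fin d) :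
    (sdiff N c (μ₀.succAbove j) *ᵥ z) (ins N μ₀ t y) = (sdiff (Nsl N μ₀) c j *ᵥ zsl N μ₀ z t) y := by
  rw [sdiff_mulVec, sdiff_mulVec, ins_add_unitVec_succAbove]; rfl

/-- **THE LONGITUDINAL DIFFERENCE ACTS ACROSS SLICES**: `(∂_{μ₀} z)(ins t y) = c·(zsl (t+1) y − zsl t y)`. [folklore] -/
theorem sdiff_self_ins (c : ℂ) (z : Tor N → ℂ) (t : ZMod (N μ₀)) (y : Tor (Nsl N μ₀)) :
    (sdiff N c μ₀ *ᵥ z) (ins N μ₀ t y) = c * (zsl N μ₀ z (t + 1) y - zsl N μ₀ z t y) := by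
  rw [sdiff_mulVec, ins_add_unitVec_self]; rfl

/-! ## §3 Splitting sums over directions -/

omit hN μ₀ in
/-- a sum over the `d + 1` directions is the `μ₀`-term plus the transversal terms. [folklore] -/
theorem sum_dir_succAbove {β : Type*} [AddCommMonoid β] (μ₀ : Fin (d + 1)) (f : Fin (d + 1) → β) :
    ∑ ν : Fin (d + 1), f ν = f μ₀ + ∑ j : Fin d, f (μ₀.succAbove j) := Fin.sum_univ_succAbove f μ₀

end Summit.QuantumFields.BalabanUV.T4Continuum.TorusSlicing

end
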